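import Mathlib

/-!
# Route FilamentSkeletonRss · crux `CoreGluing` (stmt-NavierStokesRegularity-15401) — line `Sketch`,
# stub `stub_sweptResonanceBound`

**Swept-resonance bound** (card `skew-cascade-schur`; stated verbatim as `SweptResonanceBound` in
the tree sketch `Cruxes/CoreGluing/Ideator2Sketch.lean`).

In the linearised rotated-Leray operator at a stretched vortex column the axial wavenumber `k` is
transported, and the steady problem along `k` is the complex scalar ODE

  `γ k φ'(k) + (a(k) + i Γ ω(k)) φ(k) = f(k)`

with damping `a ≥ a₀ > 0` and an arbitrary real detuning `Γ ω` (Kelvin branch). At a global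
maximum point `k₀` of `‖φ‖` one has `a₀ ‖φ(k₀)‖ ≤ ‖f(k₀)‖`, uniformly in `Γ` and `ω`: the
oscillatory term drops out of the real part.

Proof. `k ↦ ‖φ k‖ ^ 2` is differentiable with derivative `2 ⟪φ k, φ' k⟫_ℝ`
(`HasDerivAt.norm_sq`, `ℂ` as a real inner product space), and it has a global, hence local,
maximum at `k₀`, so `⟪φ k₀, φ' k₀⟫_ℝ = Re (φ'(k₀) conj φ(k₀)) = 0`. Multiplying the ODE at `k₀`
by `conj φ(k₀)` and taking real parts kills both the transport term and the purely imaginary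
detuning term, leaving `a(k₀) ‖φ(k₀)‖² = Re (f(k₀) conj φ(k₀)) ≤ ‖f(k₀)‖ ‖φ(k₀)‖`; divide by
`‖φ(k₀)‖` (the case `φ(k₀) = 0` being trivial) and use `a₀ ≤ a(k₀)`. Mathlib only.
-/

set_option linter.dupNamespace false

namespace Summit.NavierStokesRegularity.NavierStokesRegularity.Theorems

open Set Filter MeasureTheory Topology

open scoped ComplexConjugate

/-- **Registered stub `stub_sweptResonanceBound`** (line `Sketch` of the crux `CoreGluing`,
stmt-NavierStokesRegularity-15401; card `skew-cascade-schur`, Mathlib only).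
Let `φ : ℝ → ℂ` be differentiable and solve `γ k φ'(k) + (a(k) + i Γ ω(k)) φ(k) = f(k)` for all
`k`, with `a ≥ a₀ > 0`. If `‖φ‖` attains a global maximum at `k₀`, then
`a₀ ‖φ(k₀)‖ ≤ ‖f(k₀)‖`, uniformly in the detuning `Γ ω`. -/
theorem stub_sweptResonanceBound : ∀ (γ Γ a₀ : ℝ) (a ω : ℝ → ℝ) (φ f : ℝ → ℂ) (k₀ : ℝ), 0 < a₀ → Differentiable ℝ φ → (∀ k, a₀ ≤ a k) → (∀ k : ℝ, ((γ * k : ℝ) : ℂ) * deriv φ k + (((a k : ℝ) : ℂ) + ((Γ * ω k : ℝ) : ℂ) * Complex.I) * φ k = f k) → IsMaxOn (fun k => ‖φ k‖) Set.univ k₀ → a₀ * ‖φ k₀‖ ≤ ‖f k₀‖ := by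
  intro γ Γ a₀ a ω φ f k₀ _ha₀ hφ ha hode hmax
  -- Step 1: the first-order condition at the maximum, `Re (φ'(k₀) conj φ(k₀)) = 0`.
  have hd : HasDerivAt (fun k => ‖φ k‖ ^ 2) (2 * inner ℝ (φ k₀) (deriv φ k₀)) k₀ :=
    (hφ k₀).hasDerivAt.norm_sq
  have hmax2 : IsMaxOn (fun k => ‖φ k‖ ^ 2) Set.univ k₀ := by
    refine isMaxOn_iff.mpr fun k hk => ?_
    have h : ‖φ k‖ ≤ ‖φ k₀‖ := isMaxOn_iff.mp hmax k hk
    exact pow_le_pow_left₀ (norm_nonneg _) h 2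
  have hlm : IsLocalMax (fun k => ‖φ k‖ ^ 2) k₀ := hmax2.isLocalMax univ_mem
  have h0 : (deriv φ k₀).re * (φ k₀).re + (deriv φ k₀).im * (φ k₀).im = 0 := by
    have h := hlm.hasDerivAt_eq_zero hd
    simp only [Complex.inner, Complex.mul_re, Complex.conj_re, Complex.conj_im] at h
    linear_combination h / 2
  -- Step 2: real and imaginary parts of the ODE at `k₀`.
  have ere : γ * k₀ * (deriv φ k₀).re + (a k₀ * (φ k₀).re - Γ * ω k₀ * (φ k₀).im) = (f k₀).re := by
    have h := congrArg Complex.re (hode k₀)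
    simp only [Complex.add_re, Complex.mul_re, Complex.add_im, Complex.mul_im, Complex.ofReal_re,
      Complex.ofReal_im, Complex.I_re, Complex.I_im] at h
    linear_combination h
  have eim : γ * k₀ * (deriv φ k₀).im + (a k₀ * (φ k₀).im + Γ * ω k₀ * (φ k₀).re) = (f k₀).im := by
    have h := congrArg Complex.im (hode k₀)
    simp only [Complex.add_re, Complex.mul_re, Complex.add_im, Complex.mul_im, Complex.ofReal_re,
      Complex.ofReal_im, Complex.I_re, Complex.I_im] at h
    linear_combination h
  -- Step 3: the energy identity `a(k₀) ‖φ(k₀)‖² = Re (f(k₀) conj φ(k₀))`.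
  have key : a k₀ * ‖φ k₀‖ ^ 2 = (f k₀ * conj (φ k₀)).re := by
    rw [Complex.sq_norm, Complex.normSq_apply, Complex.mul_re, Complex.conj_re, Complex.conj_im]
    linear_combination (φ k₀).re * ere + (φ k₀).im * eim - γ * k₀ * h0
  -- Step 4: Cauchy–Schwarz and division by `‖φ(k₀)‖`.
  have hre : (f k₀ * conj (φ k₀)).re ≤ ‖f k₀‖ * ‖φ k₀‖ := by
    calc (f k₀ * conj (φ k₀)).re ≤ ‖f k₀ * conj (φ k₀)‖ := Complex.re_le_norm _
      _ = ‖f k₀‖ * ‖φ k₀‖ := by rw [norm_mul, Complex.norm_conj]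
  by_cases hφ0 : φ k₀ = 0
  · simp [hφ0]
  · have hpos : 0 < ‖φ k₀‖ := norm_pos_iff.mpr hφ0
    have h1 : a k₀ * ‖φ k₀‖ * ‖φ k₀‖ ≤ ‖f k₀‖ * ‖φ k₀‖ := by
      calc a k₀ * ‖φ k₀‖ * ‖φ k₀‖ = a k₀ * ‖φ k₀‖ ^ 2 := by ring
        _ = (f k₀ * conj (φ k₀)).re := key
        _ ≤ ‖f k₀‖ * ‖φ k₀‖ := hre
    calc a₀ * ‖φ k₀‖ ≤ a k₀ * ‖φ k₀‖ := mul_le_mul_of_nonneg_right (ha k₀) (norm_nonneg _)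
      _ ≤ ‖f k₀‖ := le_of_mul_le_mul_right h1 hpos

end Summit.NavierStokesRegularity.NavierStokesRegularity.Theorems
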